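import Summits.CriticalPhenomena.PercolationContinuityZ3.Theorems.PercNearOneGluingNoHeavyQuantIncomeCriterion
import HarnessLib

/-!
# QUANT lane R8, T-DEC: THE EXACT DICHOTOMY of the income criterion — (A) every nonzero low placed into mids ⟹ DEC (`flowAtT_of_midRouting`);
# (B) all mids above the target full ⟹ DEC iff the giants hold the zero plus the unplaced mass (`flowAtT_of_fullMids`)

builds on p205010 (kernel theorem, internal audit signed; external expert review pending)

Support file (`--supports stmt-CriticalPhenomena-4575`), QUANT lane seat prim-quant-arm-1 (gen 39), rung R8 of
`run/shared/lean/prim/quant/LADDER.md`.  Theorems only (no definitions), standard axioms, no sorries.  Corollaries of this seat's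
`…QuantIncomeCriterion` (`flowAtT_of_offers`, `flowAtT_of_income`).  Memo `run/shared/lean/prim/quant/prim-quant-arm-1-g39/TWIN-MOVE-G39.md` §8.

WHY.  In the primal recipe for `LawDec.TwinMoveDEC` / the move lemma (M) (transfer ANY flow of `Λ` to the lower target, re-route the blob
atom's overflow to the twins, then REFILL: move giant-routed low mass into any compatible mid with spare capacity until none is left) the final
routing `ψ` of `P`'s nonzero lows is in one of two shapes: (A) no nonzero low is left on the giants — then the income inequality holds outright,
because a mid pair at its minimal gate never runs a deficit (`usage_mid_mul_le`); or (B) some nonzero low is still giant-routed — then, `ψ` being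
refill-maximal, EVERY mid above the target is full, the cost is `Σ_{m>T}(m−T)·A m + T·W` exactly, and the income inequality is EQUIVALENT to
criterion E for the zero plus the unplaced mass `W`: `x/(1−x)·(A 0 + W) ≤ Σ_giants A`.  (Exact census, memo §8: the recipe certifies 700/700 +
3 000/3 000 boundary-pushed instances from any flow of `Λ` in any refill order.)  This file proves the two finishing moves; typer g27's dichotomy
inside `flowAtT_gateMoveBlob` is the instance with the partial flow of `…GateMoveBlobPartial`.

* **`LawDec.flowAtT_of_midRouting`** — `A ≥ 0` vanishing above `M`, with `x·M ≤ T`, `0 < T`, first moment `≥ T·mass`; a routing of every nonzero low into compatible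
  MIDS within capacity ⟹ `FlowAtT x T j′ M A`.
* **`LawDec.flowAtT_of_fullMids`** — `A ≥ 0`, mids above `T` heavy for the zero; a routing `ψ` of every nonzero low into compatible absorbers
  within capacity such that every mid `m ≤ j′`, `m ≤ M`, `T < m` is FULL (`load m = A m`), and `x/(1−x)·(A 0 + W) ≤ Σ_{j′<h≤M} A h` with
  `W` the giant-routed low mass ⟹ `FlowAtT x T j′ M A`.

[this work]; nothing here is cited as a published result.  The gluing rows served [cite: KozmaNitzan2024, Conjecture 3 (p. 15)]; product measure
[cite: Grimmett1999, §1.3 p. 10].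
-/

noncomputable section

namespace Summit.CriticalPhenomena.PercolationContinuityZ3.Theorems

namespace Quant

open Finset

namespace LawDec

/-- **(A) EVERYTHING PLACED INTO MIDS ⟹ DEC.**  `A ≥ 0` on `{0..M}`, `0 < x < 1`, `0 < T`, `x·M ≤ T`, `T·Σ A ≤ Σ h·A h`; `φ ≥ 0` charges only
pairs (nonzero low `l`, compatible MID `h ≤ j′`, `h ≤ M`, `T ≤ 2h`, `T < l + h`), routes every nonzero low completely and loads every mid by at most
its mass.  Then `FlowAtT x T j′ M A`: the cost of a mid pair is at most the income of its low (`usage_mid_mul_le`). [this work] -/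
theorem flowAtT_of_midRouting (x T : ℝ) (j' M : ℕ) (A : ℕ → ℝ) (φ : ℕ → ℕ → ℝ) (hx0 : 0 < x) (hx1 : x < 1) (hT : 0 < T)
    (hA0 : ∀ h, 0 ≤ A h) (hAM : ∀ h, M < h → A h = 0) (hta : x * (M : ℝ) ≤ T)
    (hφ0 : ∀ l h, 0 ≤ φ l h)
    (hφsupp : ∀ l h, 0 < φ l h → (1 ≤ l ∧ l ≤ j' ∧ 2 * (l : ℝ) < T) ∧ h ≤ j' ∧ h ≤ M ∧ T ≤ 2 * (h : ℝ) ∧ T < (l : ℝ) + h)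
    (hφrow : ∀ l : ℕ, 1 ≤ l → l ≤ j' → 2 * (l : ℝ) < T → ∑ h ∈ Finset.range (M + 1), φ l h = A l)
    (hφcol : ∀ h, h ≤ j' → h ≤ M → T ≤ 2 * (h : ℝ) → ∑ l ∈ Finset.range (j' + 1), usage x T j' l h * φ l h ≤ A h)
    (hmom : T * ∑ h ∈ Finset.range (M + 1), A h ≤ ∑ h ∈ Finset.range (M + 1), (h : ℝ) * A h) :
    FlowAtT x T j' M A := by
  classical
  have htaH : ∀ h : ℕ, h ≤ j' → h ≤ M → T < (h : ℝ) → x * (h : ℝ) ≤ T := fun h _ hhM _ =>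
    (mul_le_mul_of_nonneg_left (by exact_mod_cast hhM) hx0.le).trans hta
  -- no giant is charged
  have hφgiant : ∀ l h, j' + 1 ≤ h → φ l h = 0 := by
    intro l h hh
    by_contra hne
    have := (hφsupp l h (lt_of_le_of_ne (hφ0 l h) (Ne.symm hne))).2.1
    omega
  refine flowAtT_of_income x T j' M A φ hx0 hx1 hT hA0 htaH hφ0 (fun l h hp => ?_) hφrow (fun h hhM habs => ?_) hmom ?_
  · obtain ⟨hl, hhj, hhM, hmid, hc⟩ := hφsupp l h hp
    exact ⟨hl, hhM, Or.inr hc⟩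
  · rcases habs with hg | hmid
    · rw [Finset.sum_eq_zero (fun l _ => by rw [hφgiant l h hg, mul_zero])]; exact hA0 h
    · by_cases hhj : h ≤ j'
      · exact hφcol h hhj hhM hmid
      · rw [Finset.sum_eq_zero (fun l _ => by rw [hφgiant l h (by omega), mul_zero])]; exact hA0 h
  · -- COST ≤ Σ_l (T − l)·A l ≤ INCOME
    -- termwise: costCoef h · usage(l,h)·φ l h ≤ (T − l)·φ l h
    have hterm : ∀ h ∈ Finset.range (M + 1), ∀ l ∈ Finset.range (j' + 1),
        (if j' + 1 ≤ h then T * (1 - x) / x else if T < (h : ℝ) then (h : ℝ) - T else 0) * (usage x T j' l h * φ l h)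
          ≤ (T - l) * φ l h := by
      intro h hh l hl
      rcases (hφ0 l h).eq_or_lt with hz | hp
      · rw [← hz, mul_zero, mul_zero, mul_zero]
      · obtain ⟨⟨h1, hlj, hlow⟩, hhj, hhM, hmid, hc⟩ := hφsupp l h hp
        have hng : ¬ (j' + 1 ≤ h) := by omega
        rw [if_neg hng]
        by_cases hTh : T < (h : ℝ)
        · rw [if_pos hTh]
          have hu := usage_mid_mul_le x T j' l h hx0 hx1 hlow hhj hc (htaH h hhj hhM hTh)
          have : ((h : ℝ) - T) * (usage x T j' l h * φ l h) = (usage x T j' l h * ((h : ℝ) - T)) * φ l h := by ring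
          rw [this]
          exact mul_le_mul_of_nonneg_right hu hp.le
        · rw [if_neg hTh, zero_mul]
          have : (l : ℝ) < T := by linarith
          exact mul_nonneg (by linarith) hp.le
    calc ∑ h ∈ Finset.range (M + 1),
          (if j' + 1 ≤ h then T * (1 - x) / x else if T < (h : ℝ) then (h : ℝ) - T else 0)
            * ∑ l ∈ Finset.range (j' + 1), usage x T j' l h * φ l h
        = ∑ h ∈ Finset.range (M + 1), ∑ l ∈ Finset.range (j' + 1),
            (if j' + 1 ≤ h then T * (1 - x) / x else if T < (h : ℝ) then (h : ℝ) - T else 0) * (usage x T j' l h * φ l h) := by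
          refine Finset.sum_congr rfl fun h _ => ?_; rw [Finset.mul_sum]
      _ ≤ ∑ h ∈ Finset.range (M + 1), ∑ l ∈ Finset.range (j' + 1), (T - l) * φ l h :=
          Finset.sum_le_sum fun h hh => Finset.sum_le_sum fun l hl => hterm h hh l hl
      _ = ∑ l ∈ Finset.range (j' + 1), (T - l) * ∑ h ∈ Finset.range (M + 1), φ l h := by
          rw [Finset.sum_comm]; refine Finset.sum_congr rfl fun l _ => ?_; rw [Finset.mul_sum]
      _ ≤ ∑ h ∈ Finset.range (M + 1),
          (if j' + 1 ≤ h then (T - x * (h : ℝ)) / x else if (1 ≤ h ∧ (h : ℝ) < T) then T - (h : ℝ) else 0) * A h := by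
          -- the low rows are income terms; every other income term is nonnegative
          set low : ℕ → ℝ := fun l => if (1 ≤ l ∧ l ≤ j' ∧ 2 * (l : ℝ) < T) then (T - l) * A l else 0 with hlowdef
          have hrowval : ∀ l ∈ Finset.range (j' + 1), (T - l) * ∑ h ∈ Finset.range (M + 1), φ l h = low l := by
            intro l hl
            simp only [hlowdef]
            by_cases hc : (1 ≤ l ∧ l ≤ j' ∧ 2 * (l : ℝ) < T)
            · rw [if_pos hc, hφrow l hc.1 hc.2.1 hc.2.2]
            · rw [if_neg hc]
              have : ∑ h ∈ Finset.range (M + 1), φ l h = 0 := Finset.sum_eq_zero fun h _ => by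
                by_contra hne
                exact hc (hφsupp l h (lt_of_le_of_ne (hφ0 l h) (Ne.symm hne))).1
              rw [this, mul_zero]
          rw [Finset.sum_congr rfl hrowval]
          have hlow0 : ∀ l, 0 ≤ low l := fun l => by
            simp only [hlowdef]
            split_ifs with hc
            · exact mul_nonneg (by linarith [hc.2.2]) (hA0 l)
            · exact le_rfl
          -- move the low sum to `range (M+1)`
          have hmove : ∑ l ∈ Finset.range (j' + 1), low l ≤ ∑ l ∈ Finset.range (M + 1), low l := by
            by_cases hjM : j' + 1 ≤ M + 1
            · exact Finset.sum_le_sum_of_subset_of_nonneg (Finset.range_subset_range.2 hjM) fun l _ _ => hlow0 l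
            · rw [← Finset.sum_range_add_sum_Ico low (show M + 1 ≤ j' + 1 by omega)]
              have : ∑ l ∈ Finset.Ico (M + 1) (j' + 1), low l = 0 := Finset.sum_eq_zero fun l hl => by
                simp only [hlowdef]
                split_ifs
                · rw [hAM l (by have := (Finset.mem_Ico.1 hl).1; omega), mul_zero]
                · rfl
              rw [this, add_zero]
          refine hmove.trans (Finset.sum_le_sum fun h hh => ?_)
          have hhM : h ≤ M := by have := Finset.mem_range.1 hh; omega
          simp only [hlowdef]
          by_cases hc : (1 ≤ h ∧ h ≤ j' ∧ 2 * (h : ℝ) < T)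
          · rw [if_pos hc, if_neg (by omega), if_pos ⟨hc.1, by linarith [hc.2.2]⟩]
          · rw [if_neg hc]
            refine mul_nonneg ?_ (hA0 h)
            split_ifs with h1 h2
            · -- a giant `h ≤ M`: `x·h ≤ x·M ≤ T`
              have : x * (h : ℝ) ≤ T := (mul_le_mul_of_nonneg_left (by exact_mod_cast hhM) hx0.le).trans hta
              exact div_nonneg (by linarith) hx0.le
            · linarith [h2.2]
            · exact le_rfl

/-- **(B) ALL MIDS ABOVE THE TARGET FULL ⟹ (DEC ⟸ criterion E for the zero plus the unplaced mass).**  `A ≥ 0`, `0 < x < 1`, `0 < T`, mids above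
`T` heavy for the zero; `φ ≥ 0` charges only pairs (nonzero low, compatible absorber `h ≤ M`), routes every nonzero low completely, loads every
absorber by at most its mass, and loads every mid `m ≤ j′`, `m ≤ M`, `T < m` FULLY (`load m = A m`).  If `x/(1−x)·(A 0 + W) ≤ Σ_{j′ < h ≤ M} A h`
with `W = Σ_l Σ_{j′<h≤M} φ l h` the giant-routed low mass, then `FlowAtT x T j′ M A` (`flowAtT_of_offers`: the only offers left are the giants').
[this work] -/
theorem flowAtT_of_fullMids (x T : ℝ) (j' M : ℕ) (A : ℕ → ℝ) (φ : ℕ → ℕ → ℝ) (hx0 : 0 < x) (hx1 : x < 1) (hT : 0 < T)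
    (hA0 : ∀ h, 0 ≤ A h)
    (hta : ∀ h : ℕ, h ≤ j' → h ≤ M → T < (h : ℝ) → x * (h : ℝ) ≤ T)
    (hφ0 : ∀ l h, 0 ≤ φ l h)
    (hφsupp : ∀ l h, 0 < φ l h → (1 ≤ l ∧ l ≤ j' ∧ 2 * (l : ℝ) < T) ∧ h ≤ M ∧ (j' + 1 ≤ h ∨ T < (l : ℝ) + h))
    (hφrow : ∀ l : ℕ, 1 ≤ l → l ≤ j' → 2 * (l : ℝ) < T → ∑ h ∈ Finset.range (M + 1), φ l h = A l)
    (hφcol : ∀ h, h ≤ M → (j' + 1 ≤ h ∨ T ≤ 2 * (h : ℝ)) → ∑ l ∈ Finset.range (j' + 1), usage x T j' l h * φ l h ≤ A h)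
    (hfull : ∀ h : ℕ, h ≤ j' → h ≤ M → T < (h : ℝ) → ∑ l ∈ Finset.range (j' + 1), usage x T j' l h * φ l h = A h)
    (hE : x / (1 - x) * (A 0 + ∑ l ∈ Finset.range (j' + 1), ∑ h ∈ Finset.Ico (j' + 1) (M + 1), φ l h)
      ≤ ∑ h ∈ Finset.Ico (j' + 1) (M + 1), A h) :
    FlowAtT x T j' M A := by
  classical
  have h1x : 0 < 1 - x := by linarith
  refine flowAtT_of_offers x T j' M A φ hx0 hx1 hT hA0 hta hφ0 hφsupp hφrow hφcol ?_
  -- the offer of each atom: `0` below the layer (full mids / no offer), `T(1−x)/x·(A h − x/(1−x)·W_h)` at a giant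
  have hterm : ∀ h ∈ Finset.range (M + 1),
      (if j' + 1 ≤ h then T * (1 - x) / x else if T < (h : ℝ) then (h : ℝ) - T else 0)
        * (A h - ∑ l ∈ Finset.range (j' + 1), usage x T j' l h * φ l h)
      = if j' + 1 ≤ h then T * (1 - x) / x * A h - T * ∑ l ∈ Finset.range (j' + 1), φ l h else 0 := by
    intro h hh
    have hhM : h ≤ M := by have := Finset.mem_range.1 hh; omega
    by_cases hg : j' + 1 ≤ h
    · rw [if_pos hg, if_pos hg]
      have e : ∑ l ∈ Finset.range (j' + 1), usage x T j' l h * φ l h = x / (1 - x) * ∑ l ∈ Finset.range (j' + 1), φ l h := by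
        rw [Finset.mul_sum]
        exact Finset.sum_congr rfl fun l _ => by rw [usage_giant_eq x T j' l h hg]
      rw [e]
      field_simp
    · rw [if_neg hg, if_neg hg]
      by_cases hTh : T < (h : ℝ)
      · rw [if_pos hTh, hfull h (by omega) hhM hTh, sub_self, mul_zero]
      · rw [if_neg hTh, zero_mul]
  rw [Finset.sum_congr rfl hterm]
  -- restrict to the giants `Ico (j'+1) (M+1)`
  have hsplit : ∑ h ∈ Finset.range (M + 1),
      (if j' + 1 ≤ h then T * (1 - x) / x * A h - T * ∑ l ∈ Finset.range (j' + 1), φ l h else 0)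
      = ∑ h ∈ Finset.Ico (j' + 1) (M + 1), (T * (1 - x) / x * A h - T * ∑ l ∈ Finset.range (j' + 1), φ l h) := by
    rw [← Finset.sum_filter]
    congr 1
    ext h
    simp only [Finset.mem_filter, Finset.mem_range, Finset.mem_Ico]
    omega
  rw [hsplit, Finset.sum_sub_distrib, ← Finset.mul_sum, ← Finset.mul_sum, Finset.sum_comm]
  -- `hE` multiplied by `T(1−x)/x`
  have hE' := mul_le_mul_of_nonneg_left hE (show 0 ≤ T * (1 - x) / x from div_nonneg (mul_nonneg hT.le h1x.le) hx0.le)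
  have e1 : T * (1 - x) / x * (x / (1 - x) * (A 0 + ∑ l ∈ Finset.range (j' + 1), ∑ h ∈ Finset.Ico (j' + 1) (M + 1), φ l h))
      = T * A 0 + T * ∑ l ∈ Finset.range (j' + 1), ∑ h ∈ Finset.Ico (j' + 1) (M + 1), φ l h := by
    field_simp
  rw [e1] at hE'
  linarith

end LawDec

end Quant

end Summit.CriticalPhenomena.PercolationContinuityZ3.Theorems
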